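import Literature.AlgebraicGeometry.Motives.CompleteIntersection
import Literature.AlgebraicGeometry.Resolution.AlterationsStrictTransformModel
import HarnessLib

/-!
# Crux `PadicSemiregularLift.SemiregularSeedsOnAnchors` (stmt-HodgeConjecture-13941), line
# `gorenstein-ci-seeds`, stub S2 `stub_serreBundle_exists`: helpers (factorisation of the reduced
# complete intersection through the hypersurface)

LOG (worker S2, 2026-08-16).
* This file: the FIRST conjunct of `IsHartshorneSerreOf ι Z.f E` — the reduced complete
  intersection `V₊(f₁,f₂,f₃) ↪ ℙ⁵` factors through any closed immersion `ι : X ↪ ℙ⁵` whose image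
  contains `V₊(f)` (in particular through `X` with image `V₊(F)`, `F = Σ fᵢ gᵢ ∈ (f)`), because the
  source is reduced (tree: `Resolution.IsClosedImmersion.liftOfRange`, Hartshorne II Ex. 3.11 (d)).
  Pure Mathlib / Literature vocabulary, theorem-only.

Contents:
* `zeroLocus_subset_zeroLocus_singleton_of_mem_span` — `G ∈ (f) ⟹ V₊(f) ⊆ V₊(G)`;
* `zeroLocus_subset_zeroLocus_sum_mul` — `V₊(f) ⊆ V₊(Σ fᵢ gᵢ)`;
* `exists_comp_eq_completeIntersectionι_of_subset_range` — `V₊(f) ⊆ im ι ⟹ ∃ j, j ≫ ι = (V₊(f) ↪ ℙᴺ)`;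
* `isClosedImmersion_of_comp_eq_completeIntersectionι`, `range_left_of_comp_eq_completeIntersectionι`
  — any such `j` is a closed immersion with image `ι⁻¹ V₊(f)`;
* `exists_completeIntersection_hom_comp_eq` — the registered sub-goal: for `F = Σ fᵢ gᵢ` and
  `im ι = V₊(F)`, `∃ j : completeIntersection f ⟶ X, j ≫ ι = completeIntersectionι f`.
-/

noncomputable section

-- `Summit.HodgeConjecture.HodgeConjecture.…` (summit = problem) duplicates a namespace component by design (D-0017).
set_option linter.dupNamespace false

open CategoryTheory AlgebraicGeometry
open Literature.AlgebraicGeometry.Motives Literature.AlgebraicGeometry.Resolution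

universe u v

namespace Summit.HodgeConjecture.HodgeConjecture.Theorems.SemiregularSeedsOnAnchors.GorensteinCiSeeds

section ZeroLocus

variable {k : Type u} [Field k] {N : ℕ} {ι : Type v}

/-- `G ∈ (f) ⟹ V₊(f) ⊆ V₊(G)`: a homogeneous prime containing every `f_a` contains the ideal they
generate. [folklore] -/
theorem zeroLocus_subset_zeroLocus_singleton_of_mem_span (f : ι → MvPolynomial (Fin (N + 1)) k)
    {G : MvPolynomial (Fin (N + 1)) k} (hG : G ∈ Ideal.span (Set.range f)) :
    letI := MvPolynomial.gradedAlgebra (σ := Fin (N + 1)) (R := k)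
    ProjectiveSpectrum.zeroLocus (MvPolynomial.homogeneousSubmodule (Fin (N + 1)) k) (Set.range f) ⊆
      ProjectiveSpectrum.zeroLocus (MvPolynomial.homogeneousSubmodule (Fin (N + 1)) k) {G} := by
  letI := MvPolynomial.gradedAlgebra (σ := Fin (N + 1)) (R := k)
  intro p hp
  rw [ProjectiveSpectrum.mem_zeroLocus, Set.singleton_subset_iff, SetLike.mem_coe]
  rw [ProjectiveSpectrum.mem_zeroLocus] at hp
  have h : Ideal.span (Set.range f) ≤ p.asHomogeneousIdeal.toIdeal := Ideal.span_le.mpr hp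
  exact h hG

/-- `V₊(f₁, …, f_c) ⊆ V₊(Σ fᵢ gᵢ)`. [folklore] -/
theorem zeroLocus_subset_zeroLocus_sum_mul [Fintype ι] (f g : ι → MvPolynomial (Fin (N + 1)) k) :
    letI := MvPolynomial.gradedAlgebra (σ := Fin (N + 1)) (R := k)
    ProjectiveSpectrum.zeroLocus (MvPolynomial.homogeneousSubmodule (Fin (N + 1)) k) (Set.range f) ⊆
      ProjectiveSpectrum.zeroLocus (MvPolynomial.homogeneousSubmodule (Fin (N + 1)) k)
        {∑ i, f i * g i} :=
  zeroLocus_subset_zeroLocus_singleton_of_mem_span f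
    (Ideal.sum_mem _ fun i _ => Ideal.mul_mem_right _ _ (Ideal.subset_span ⟨i, rfl⟩))

end ZeroLocus

section Factorisation

variable {k : Type u} [Field k] {N : ℕ} {ι : Type v}

-- The grading `MvPolynomial.gradedAlgebra` is the one baked into `projectiveSpace` and
-- `completeIntersection`; it is supplied term-wise (`letI` / `@`) in each statement.

/-- **The reduced complete intersection factors through any closed subscheme containing it**: if
`ι : X ↪ ℙᴺ_k` is a closed immersion (of `k`-schemes) whose image contains `V₊(f)`, there is
`j : V₊(f) ⟶ X` over `k` with `j ≫ ι = (V₊(f) ↪ ℙᴺ_k)`; here `V₊(f) = completeIntersection f` carries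
its reduced induced structure, so the tree's `IsClosedImmersion.liftOfRange` (the kernel of a
morphism with reduced source is the vanishing ideal sheaf of its image) applies.
[cite: Hartshorne1977, II Ex. 3.11 (c)–(d)] -/
theorem exists_comp_eq_completeIntersectionι_of_subset_range (f : ι → MvPolynomial (Fin (N + 1)) k)
    {X : SchemeOver k} (i : X ⟶ projectiveSpace N k) [IsClosedImmersion i.left]
    (h : letI := MvPolynomial.gradedAlgebra (σ := Fin (N + 1)) (R := k)
      ProjectiveSpectrum.zeroLocus (MvPolynomial.homogeneousSubmodule (Fin (N + 1)) k)
        (Set.range f) ⊆ Set.range i.left) :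
    ∃ j : completeIntersection f ⟶ X, j ≫ i = completeIntersectionι f := by
  letI := MvPolynomial.gradedAlgebra (σ := Fin (N + 1)) (R := k)
  have hsub : Set.range (completeIntersectionι f).left ⊆ Set.range i.left := by
    rw [range_completeIntersectionι]
    exact h
  have fac : IsClosedImmersion.liftOfRange i.left (completeIntersectionι f).left hsub ≫ i.left =
      (completeIntersectionι f).left :=
    IsClosedImmersion.liftOfRange_fac _ _ _
  refine ⟨Over.homMk (IsClosedImmersion.liftOfRange i.left (completeIntersectionι f).left hsub) ?_,
    ?_⟩
  · rw [← Over.w i, ← Category.assoc, fac]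
    exact Over.w (completeIntersectionι f)
  · ext : 1
    rw [Over.comp_left]
    exact fac

/-- Any `j : V₊(f) ⟶ X` with `j ≫ ι = (V₊(f) ↪ ℙᴺ)` is a closed immersion on underlying schemes
(`ι` being a closed immersion). [folklore] -/
theorem isClosedImmersion_of_comp_eq_completeIntersectionι (f : ι → MvPolynomial (Fin (N + 1)) k)
    {X : SchemeOver k} (i : X ⟶ projectiveSpace N k) [IsClosedImmersion i.left]
    (j : completeIntersection f ⟶ X) (hj : j ≫ i = completeIntersectionι f) :
    IsClosedImmersion j.left := by
  haveI : IsClosedImmersion (j.left ≫ i.left) := by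
    rw [← Over.comp_left, hj]
    infer_instance
  exact IsClosedImmersion.of_comp_isClosedImmersion _ i.left

/-- Any `j : V₊(f) ⟶ X` with `j ≫ ι = (V₊(f) ↪ ℙᴺ)` has image `ι⁻¹ V₊(f)`. [folklore] -/
theorem range_left_of_comp_eq_completeIntersectionι (f : ι → MvPolynomial (Fin (N + 1)) k)
    {X : SchemeOver k} (i : X ⟶ projectiveSpace N k) [IsClosedImmersion i.left]
    (j : completeIntersection f ⟶ X) (hj : j ≫ i = completeIntersectionι f) :
    letI := MvPolynomial.gradedAlgebra (σ := Fin (N + 1)) (R := k)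
    Set.range j.left =
      i.left ⁻¹' ProjectiveSpectrum.zeroLocus (MvPolynomial.homogeneousSubmodule (Fin (N + 1)) k)
        (Set.range f) := by
  letI := MvPolynomial.gradedAlgebra (σ := Fin (N + 1)) (R := k)
  have hinj : Function.Injective i.left := i.left.isClosedEmbedding.injective
  have hcomp : j.left ≫ i.left = (completeIntersectionι f).left := by rw [← Over.comp_left, hj]
  ext x
  constructor
  · rintro ⟨z, rfl⟩
    rw [Set.mem_preimage, ← range_completeIntersectionι f, ← Scheme.Hom.comp_apply, hcomp]
    exact ⟨z, rfl⟩
  · intro hx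
    rw [Set.mem_preimage, ← range_completeIntersectionι f] at hx
    obtain ⟨z, hz⟩ := hx
    refine ⟨z, hinj ?_⟩
    rw [← Scheme.Hom.comp_apply, hcomp, hz]

/-- **Registered sub-goal (first conjunct of `IsHartshorneSerreOf`)**: for forms `f₁,f₂,f₃,g₁,g₂,g₃`
in six variables with `Σ fᵢ gᵢ = F` and a closed `k`-immersion `ι : X ↪ ℙ⁵_k` with image `V₊(F)`,
the reduced complete intersection `V₊(f₁,f₂,f₃) ↪ ℙ⁵_k` factors through `ι`.
[cite: Hartshorne1977, II Ex. 3.11 (c)–(d)] -/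
theorem exists_completeIntersection_hom_comp_eq :
    ∀ (k : Type u) [Field k] (F : MvPolynomial (Fin 6) k) (f g : Fin 3 → MvPolynomial (Fin 6) k)
      (_ : ∑ i, f i * g i = F) (X : SchemeOver k) (ι : X ⟶ projectiveSpace 5 k)
      [IsClosedImmersion ι.left]
      (_ : Set.range ι.left.base =
        @ProjectiveSpectrum.zeroLocus _ _ _ _ _ (MvPolynomial.homogeneousSubmodule (Fin 6) k)
          MvPolynomial.gradedAlgebra {F}),
      ∃ j : completeIntersection f ⟶ X, j ≫ ι = completeIntersectionι f := by
  intro k _ F f g hF X ι _ hι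
  letI := MvPolynomial.gradedAlgebra (σ := Fin 6) (R := k)
  refine exists_comp_eq_completeIntersectionι_of_subset_range f ι ?_
  change _ ⊆ Set.range ι.left.base
  rw [hι, ← hF]
  exact zeroLocus_subset_zeroLocus_sum_mul f g

end Factorisation

end Summit.HodgeConjecture.HodgeConjecture.Theorems.SemiregularSeedsOnAnchors.GorensteinCiSeeds

end
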